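import Literature.Barriers.Parity.GoldbachAverageZerosProofs
import Literature.Barriers.Parity.GoldbachAverageZerosBHMSProofs
import HarnessLib

/-!
# Barrier catalogue `Parity`, entry `GoldbachAverageZeros` — CONFIRMED and SHARPENED (barrier audit 2026-08-16, D-0021)

Topic `Literature/Barriers/Parity`. The catalogued record
`Literature.Barriers.Parity.GoldbachAverageZeros` (Bhowmik–Ruzsa 2018, Theorem 2.1: a power saving
`S(x) = ∑_{n ≤ x} G(n) = x²/2 + O(x^{2−δ})` forces a zero-free half-plane `Re s > 1 − δ'` for
`ζ`) is TRUE and PROVED in the tree (`GoldbachAverageZeros_holds`), and so are the two vendored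
companions (`BHMS2019_thm1_i_holds`, file `GoldbachAverageZerosBHMSProofs.lean`;
`BHMS2019_thm1_ii_holds`, file `GoldbachAverageZerosProofs.lean`). Nothing in the entry is false.
What the audit corrects is SLACK in the catalogued block, in the direction that makes the barrier
bite harder — so no technique is released by it:

1. **The exponent is sharp: `δ' = δ`.** The block records `δ' = δ/6` (printed proof), `δ/24`
   (the tree's discretised proof) and "`δ' = δ` only through an explicit expression of `S(x)` using
   roots of the zeta-function in the cited works" (`scope_caveats` (b), (e)). But the case `q = 1`,
   `a = b` of Bhowmik–Halupczok–Matsumoto–Suzuki's Theorem 1 (2) — vendored in the same file as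
   `BHMS2019_thm1_ii` and PROVED in the tree by Laplace transforms on the real axis, with no
   explicit formula — is exactly the sharp statement: at modulus `1` the Distinct Zero Conjecture
   is vacuous (there is one character) and `χ(a) + χ(b) = 2 ≠ 0`, so
   `S(x) = x²/2 + O(x^{1+d+ε})` for every `ε > 0` (`1/2 ≤ d < 1`) gives `B ≤ d`, i.e.
   `S(x) = x²/2 + O(x^{2−δ})`, `0 < δ ≤ 1/2`, forces `Re ρ ≤ 1 − δ` for every non-trivial zero.
   This is how the 2025 literature states the record ("an essentially best-possible result has
   been obtained by a different method in [BHMS 2019]", Billington–Cheng–Schettler–Suriajaya).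
   The sharp record is `GoldbachAverageZerosNarrow` below, PROVED (`GoldbachAverageZerosNarrow_holds`);
   it implies the catalogued one (`goldbachAverageZeros_of_narrow`), and at `δ ≥ 1/2` it is the
   Riemann hypothesis itself (`PowerSavingGoldbachAverage.riemannHypothesis`). With the converse
   direction (under `B ≤ 1 − δ < 1` the explicit formula gives `S(x) = x²/2 + O(x^{2−δ}(log x)²)`,
   Granville (5.1) / BHMS (1.5)) the technique-class parameter and the zero-free half-plane now
   carry the SAME exponent: a power saving `x^{2−δ}` on average is exactly as hard as the
   quasi-Riemann hypothesis `B ≤ 1 − δ`, not merely as hard as "some" zero-free half-plane.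
2. **Sub-power savings are covered too** (`scope_caveats` (a) of the block said savings by powers
   of `log x` "are not addressed by the sources"). Billington–Cheng–Schettler–Suriajaya (2025)
   prove the Goldbach analogue of the Ingham / Turán–Staś–Pintz correspondence: a zero-free
   region `σ > 1 − η(|t|)` gives `G(N) = N²/2 + O(N² exp(−Cω(N)))` (Theorem 1; with the
   Vinogradov–Korobov region, `O(N² exp(−c'(log N)^{3/5}(log log N)^{−1/5}))`, Corollary 1 — the
   best UNCONDITIONAL saving in print), and conversely a saving `O(N² exp(−Cϖ(N)))` with `C > 5A`
   forces `ζ(σ + it) ≠ 0` for `σ > 1 − η(log|t|)`, `|t|` large (Theorem 2, "new and essentially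
   optimal in the case when `η(|t|) → 0`"). So every saving in the averaged Goldbach asymptotic
   beyond the shape delivered by the best known zero-free region is itself a new zero-free region:
   the barrier is broader than "power savings". (Quoted, not vendored: the statements involve the
   Ingham functions `ω`, `ϖ` of a general region and are not needed by any tree declaration.)

Two remarks on the parameter range of the technique class `PowerSavingGoldbachAverage δ`
(information for planners, not new obstructions): for `δ > 1/2` the class implies RH (item 1) and
is at the same time expected to be EMPTY — under RH `G(N) = N²/2 + 2R₁(N) + O(N log³N)`
(Languasco–Zaccagnini) with `R₁(N) = −∑_ρ N^{ρ+1}/(ρ(ρ+1)) + O(N) = Ω_±(N^{3/2})`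
[cite: BillingtonEtAl2023, §2 (the displays before Lemma 1)]; and for `δ > 1` it is empty for the
trivial reason that `G(n) ≪ log² n` for odd `n` [cite: GoldstonSuriajaya2021, §1 (display `ψ₂(n) ≪ log² n`)], so that
`S(x) − x²/2` jumps by `x + O(log² x)` at odd `x`. Only `0 < δ ≤ 1/2` is live, and there the
sharp record applies.

## What the sources print (arXiv versions; verified on the page)

* G. Bhowmik, K. Halupczok, K. Matsumoto, Y. Suzuki, Mathematika 65 (2019) 57–97
  (arXiv:1704.06103) [cite: BhowmikHalupczokMatsumotoSuzuki2019, Theorem 1 (2), Remark 1, §7 (Proposition 3), §8].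
  Theorem 1 (2): "Let DZC be true, let `χ(a) + χ(b) ≠ 0` for all characters `χ (mod q)` and let
  `1/2 ≤ d < 1`. If the asymptotic formula `S(x;q,a,b) = x²/(2φ(q)²) + O_q(x^{1+d+ε})` holds for
  any `ε > 0`, then `B_q ≤ d` or `B_q = 1`. Further if [it] holds with `a = b`, then `B_q ≤ d`."
  Remark 1: "Using a yet unpublished idea of I. Ruzsa, we were able to exclude this possibility
  [`B_q = 1`] for the case `a = b` under the DZC. Thus the proof of the equivalence between the RH
  and (1.1) is now complete (see also [BRu])." §8 ("Exclusion of `B_q = 1` for `a = b`"): "We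
  prove that (8.1) together with DZC implies that `B_q < 1`" — power series
  `F_{a,q}(z) = ∑_{n ≡ a} Λ(n)zⁿ` on `|z| = e^{−1/N}`, "Because there are only non-negative
  coefficients, the left-hand side in (8.5) is non-negative for the choice `z = e^{−1/N}` … the
  sign `±` … is `+`. At this point we notice that we are unable to obtain a similar asymptotic
  formula when `a ≠ b`."; §7, Proposition 3: `∑ G(n;q,a,b)n^{−s}` "can be continued
  meromorphically to the half plane `σ > 2B_q`", with "a possible pole at `s = ρ_q + 1` … with
  residue `r(ρ_q) = −φ(q)⁻²ρ_q⁻¹∑_{χ: L(ρ_q,χ)=0}(χ̄(a)+χ̄(b))m_χ(ρ_q)`".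
* K. Billington, M. Cheng, J. Schettler, A. I. Suriajaya, *The average number of Goldbach
  representations and zero-free regions of the Riemann zeta-function*, Int. J. Number Theory 21
  (2025) 289–316 (arXiv:2306.09102) [cite: BillingtonEtAl2023, §1 (Theorems 1–3, Corollaries 1–2, the paragraph after Theorem 2), §2 (the displays before Lemma 1, Lemma 1)].
  `G(N) := ∑_{n ≤ N} ψ₂(n)`, `ψ₂(n) = ∑_{m+m'=n}Λ(m)Λ(m')` (= the tree's `goldbachLambdaSum`).
  Theorem 1: "If `ζ(σ+it) ≠ 0` in the region `σ > 1 − η(|t|)` … then there exists a constant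
  `0 < C < 1` such that for `N ≥ 4`, `G(N) = N²/2 + O(N² exp(−Cω(N)))`",
  `ω(x) = min_{u ≥ 1}(η(u) log x + log u)`; Corollary 1 (region
  `η(u) = c/((log(u+3))^a (log log(u+3))^b)`): `G(N) = N²/2 + O(N² exp(−c'(log N)^{1/(1+a)}(log log N)^{−b/(1+a)}))`,
  "the currently best known zero-free region is the case when `a = 2/3` and `b = 1/3`, due to
  Korobov and Vinogradov". Theorem 2: "if for `N ≥ 4` and some constant `C > 5A`,
  `G(N) = N²/2 + O(N² exp(−Cϖ(N)))`, then for all sufficiently large `|t|`, `ζ(σ+it) ≠ 0` in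
  the region `σ > 1 − η(log|t|)`", `ϖ(x) = min_{u ≥ 0}(η(u) log x + u)`; "The result in Theorem 2
  is new and essentially optimal in the case when `η(|t|) → 0` as `|t| → ∞`. Our method, which is
  based on [BhowRuzsa2018], is inefficient in the quasi-RH and RH case. In these cases, however,
  an essentially best-possible result has been obtained by a different method in [BHMS 2019].
  More precisely, they showed that if for `N ≥ 4` and some constant `0 < c ≤ 1/2`, if
  `G(N) = N²/2 + O(N^{2−c+ε})` holds for any `ε > 0`, then `ζ(s) ≠ 0` in the region
  `Re(s) > 1 − c`." Theorem 3 (smooth average `F(N) = ∑ ψ₂(n)e^{−n/N}`): a region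
  `σ > 1 − η(|t|)` gives `F(N) = N² + O(N^{2−η(log N)})`. §2: under RH
  `G(N) = N²/2 + 2R₁(N) + O(N log³N)` (Languasco–Zaccagnini), unconditionally
  `G(N) = N²/2 + 2R₁(N) + Ω(N log log N)` (Bhowmik–Schlage-Puchta), and "using any zero of the
  Riemann zeta-function on the line `Re(s) = 1/2` … `R₁(N) = Ω_±(N^{3/2})`"; Lemma 1:
  `G(N) = N²/2 + 2R₁(N) + ∑_{n ≤ N}Λ₀(n)R(N−n) + O(N)`.
* D. A. Goldston, A. I. Suriajaya, *On an average Goldbach representation formula of Fujii*,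
  Nagoya Math. J. 250 (2023) 511–532 (arXiv:2110.14250) [cite: GoldstonSuriajaya2023Fujii, §1].
  "Unconditionally, Bhowmik and Ruzsa showed that the estimate `∑_{n ≤ N}ψ₂(n) = N²/2 + O(N^{2−δ})`
  implies that for all complex zeros `ρ = β + iγ` … `β < 1 − δ/6`" (the exponent as catalogued);
  the paper's subject is the error `G(N) − N²/2 − 2R₁(N)` under RH, not the converse direction.
* D. A. Goldston, A. I. Suriajaya, *Note on the Goldbach conjecture and Landau–Siegel zeros*
  (arXiv:2104.09407) [cite: GoldstonSuriajaya2021, §1 (display `ψ₂(n) ≪ log² n`, Theorem 1)]. "`ψ₂(n) ≪ log² n`,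
  for `n` odd" ("the only possible non-zero terms … are when `m` or `m'` is a power of `2`"); the
  note's Theorem 1 (a factor-`(1−δ)` two-sided Hardy–Littlewood bound for all large even `n` gives
  `β₁ < 1 − C(δ)/log²q`; Fei 2016, Bhowmik–Halupczok 2020, Jia 2020 for `χ(−1) = −1`) concerns
  individual LOWER/UPPER BOUNDS against Siegel zeros and belongs to the Siegel-zero entries of this
  catalogue, not to the power-saving class recorded here.
* G. Bhowmik, I. Z. Ruzsa, Anal. Math. 44 (2018) 51–56 (arXiv:1711.06442)
  [cite: BhowmikRuzsa2018, Theorem 2.1 and Remark 1]: "which proves the theorem with `δ' = δ/6`";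
  Remark 1: "the methods of [1,2,4] give `δ' = δ` as soon as we have `δ' < 1`, through an explicit
  expression of `S(x)` using roots of the zeta-function. We are unable to get `δ' = δ` directly by
  the simple method of this paper and we think it cannot be done."

## Contents

* `GoldbachAverageZerosNarrow` — the sharp record (docstring = BARRIER block), PROVED
  (`GoldbachAverageZerosNarrow_holds`) from `BHMS2019_thm1_ii_holds` at modulus `1`;
* `goldbachAverageZeros_of_narrow` — it implies the catalogued record (with `δ' = min(δ, 1/2)/2`);
* `GoldbachAverageZerosNarrow.re_le` (`Re ρ ≤ 1 − δ`), `PowerSavingGoldbachAverage.riemannHypothesis`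
  (`δ ≥ 1/2` gives Mathlib's `RiemannHypothesis`);
* glue: `goldbachLambdaSumMod_one_eq`, `PowerSavingGoldbachAverage.bhms_hypothesis_modOne`,
  `zerosRealPartLE_one_of_powerSaving`.
-/

noncomputable section

open Filter Finset Asymptotics
open Literature.NumberTheory.LFunctions

namespace Literature.Barriers.Parity

/-! ### The sharp record -/

/-- **Barrier (sharp form): a power saving `x^{2−δ}` in the averaged Goldbach asymptotic is the
quasi-Riemann hypothesis `B ≤ 1 − δ` with the SAME exponent** (Bhowmik–Halupczok–Matsumoto–Suzuki
2019, Theorem 1 (2) at modulus `q = 1`, `a = b`; stated in this form by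
Billington–Cheng–Schettler–Suriajaya 2025). For `0 < δ ≤ 1/2`:
`S(x) = x²/2 + O(x^{2−δ})` (`PowerSavingGoldbachAverage δ`) implies that `ζ` has no zeros in the
strip `1 − δ < Re s < 1` (`Literature.NumberTheory.LFunctions.QuasiRiemannHypothesis (1 − δ)`).
PROVED below (`GoldbachAverageZerosNarrow_holds`); implies the catalogued existential record
`GoldbachAverageZeros` (`goldbachAverageZeros_of_narrow`).
[cite: BhowmikHalupczokMatsumotoSuzuki2019, Theorem 1 (2)] [cite: BillingtonEtAl2023, §1 (paragraph after Theorem 2)]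

BARRIER (D-0021; one line per key):
technique_class: zero-free-region-blind power-saving averaged-goldbach circle-method explicit-formula — unchanged from `GoldbachAverageZeros`: any argument whose conclusion is, or implies, `PowerSavingGoldbachAverage δ` for some `δ > 0` (monotone in `δ`, `PowerSavingGoldbachAverage.mono`), in particular any power-saving binary Goldbach asymptotic `G(2N) = J(2N) + O(N^{1−δ})` for all `N` [cite: BhowmikRuzsa2018, Theorem 2.1]; SHARPENED reading: the live parameter range is `0 < δ ≤ 1/2` — at `δ ≥ 1/2` the class is the Riemann hypothesis (`PowerSavingGoldbachAverage.riemannHypothesis`) and is expected to be empty above `1/2` (`R₁(N) = Ω_±(N^{3/2})` against `G(N) = N²/2 + 2R₁(N) + O(N log³N)` under RH) [cite: BillingtonEtAl2023, §2 (the displays before Lemma 1)], and for `δ > 1` it is empty because `G(n) ≪ log²n` at odd `n` [cite: GoldstonSuriajaya2021, §1 (display `ψ₂(n) ≪ log² n`)]; BROADENED reading: savings of intermediate strength `O(N² exp(−Cϖ(N)))` (between log-powers and powers) are tied to zero-free REGIONS `σ > 1 − η(log|t|)` in the same way [cite: BillingtonEtAl2023, §1 (Theorem 2)].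
blocks: the power-saving strengthening, on average over the target `N' ≤ x`, of the binary Goldbach case of `GeneralizedHardyLittlewood` = `Literature.NumberTheory.Sieve.GeneralizedHardyLittlewood`, with the SHARP exponent: `S(x) = x²/2 + O(x^{2−δ})`, `0 < δ ≤ 1/2`, forces `Re ρ ≤ 1 − δ` for every non-trivial zero of `ζ` (`GoldbachAverageZerosNarrow`, `GoldbachAverageZerosNarrow.re_le`), i.e. the quasi-Riemann hypothesis `Literature.NumberTheory.LFunctions.QuasiRiemannHypothesis (1 − δ)`, and `δ ≥ 1/2` forces `RiemannHypothesis` [cite: BhowmikHalupczokMatsumotoSuzuki2019, Theorem 1 (2) and Remark 1] [cite: BillingtonEtAl2023, §1 (paragraph after Theorem 2)]; since conversely `B ≤ 1 − δ < 1` gives `S(x) = x²/2 − 2∑_{|Im ρ| ≤ x}x^{ρ+1}/(ρ(ρ+1)) + O(x^{(2+4B)/3}(log x)²) = x²/2 + O(x^{2−δ}(log x)²)` [cite: BhowmikHalupczokMatsumotoSuzuki2019, §1 (1.5)] [cite: Granville2007, §5 (5.1)], a saving `x^{2−δ}` on average is EXACTLY as hard as `B ≤ 1 − δ` (up to `x^{o(1)}`),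 not merely as hard as some zero-free half-plane `Re s > 1 − δ/6`; and below power scale, any saving `O(N² exp(−Cϖ(N)))` beyond the shape `N² exp(−c'(log N)^{3/5}(log log N)^{−1/5})` that the Vinogradov–Korobov region already gives unconditionally is a new zero-free region `σ > 1 − η(log|t|)` [cite: BillingtonEtAl2023, §1 (Theorem 1, Corollary 1, Theorem 2)].
because: on the positive real axis the power series `F(t) = ∑ Λ(n)e^{−nt} ≥ 0` has `F(t)² = (1 − e^{−t})∑ S(n)e^{−nt} = t^{−2} + O(t^{δ−2})` under the hypothesis, so the REAL square root gives `E(t) = F(t) − e^{−t}/t = O(t^{δ−1})` with no loss, and the Mellin transform `∫₀^∞ E(t)t^{s−1}dt = Γ(s)(−ζ'/ζ(s) − 1/(s−1))` is then holomorphic on `Re s > 1 − δ`, which excludes zeros there (tree: `BHMS.zerosRealPartLE_of_self`, `Literature.NumberTheory.LFunctions.LaplaceProgressions.apply_inv_add_apply_inv_eq_zero`, the Landau step being trivial at modulus `1`); this is the `a = b` mechanism of the source ("Because there are only non-negative coefficients … the sign `±` … is `+`"), run on the Mellin side instead of through the kernel `K(z)` and the minor arcs, which is where Bhowmik–Ruzsa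 lose the factor `6` ("We are unable to get `δ' = δ` directly by the simple method of this paper") [cite: BhowmikHalupczokMatsumotoSuzuki2019, §8 and §7 (Proposition 3)] [cite: BhowmikRuzsa2018, Remark 1]; for general regions the same square-root step feeds the Turán–Staś–Pintz converse `R(x) = O(x exp(−(1+ε)ϖ(x))) ⟹ ζ ≠ 0 on σ > 1 − η(log|t|)` [cite: BillingtonEtAl2023, §1 (PNT-ZFR (b), Theorem 2)].
evasions_known: none for power savings (unchanged); the unconditional savings in print are those delivered by zero-free regions, the best being `G(N) = N²/2 + O(N² exp(−c'(log N)^{3/5}(log log N)^{−1/5}))` from the Vinogradov–Korobov region [cite: BillingtonEtAl2023, §1 (Theorem 1, Corollary 1)]; CONDITIONALLY, under RH `G(N) = N²/2 + 2R₁(N) + O(N log³N)` (Languasco–Zaccagnini; Bhowmik–Schlage-Puchta `O(N log⁵N)`; unconditionally `Ω(N log log N)` in place of the `O`) [cite: BillingtonEtAl2023, §2 (the displays before Lemma 1)] [cite: GoldstonSuriajaya2023Fujii, §1]; in progressions as catalogued (`BHMS2019_thm1_i`, PROVED: `BHMS2019_thm1_i_holds`).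
scope_caveats: (a) replaces (a) of `GoldbachAverageZeros`: sub-power savings ARE addressed — Theorem 2 of Billington–Cheng–Schettler–Suriajaya needs the saving with a constant `C > 5A` (`A > 1` fixed) in `exp(−Cϖ(N))` and the regularity conditions of the Ingham–Pintz theorem on `η` (continuous, decreasing, `0 < η ≤ 1/2`, `η'(u) → 0`), and concludes the region only for `|t|` sufficiently large; savings by fixed powers of `log N` correspond to no region of this shape and remain unaddressed; these statements are quoted, not vendored [cite: BillingtonEtAl2023, §1 (PNT-ZFR, Theorem 2)]; (b) replaces (b), (e) of `GoldbachAverageZeros`: the exponent is sharp, `δ' = δ` in the sense `Re ρ ≤ 1 − δ` (`0 < δ ≤ 1/2`), PROVED here from the tree's proof of `BHMS2019_thm1_ii` at modulus `1` (Laplace transforms on the real axis; the printed route is the explicit formula, Theorem 2 and Proposition 3 of the source, after §8 has excluded `B = 1`) [cite: BhowmikHalupczokMatsumotoSuzuki2019, Theorem 1 (2), §7, §8]; the record is stated for `δ ≤ 1/2` only because `d = 1 − δ ≥ 1/2` is the printed range (the Landau step avoids `s = 1/2`); for `δ ≥ 1/2` use monotonicity and `PowerSavingGoldbachAverage.riemannHypothesis`;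 (c) the emptiness of the class for `δ > 1/2` (via `R₁(N) = Ω_±(N^{3/2})` and the Languasco–Zaccagnini formula) and for `δ > 1` (parity of `n`) is quoted above, not formalised [cite: BillingtonEtAl2023, §2 (the `Ω_±(N^{3/2})` display)] [cite: GoldstonSuriajaya2021, §1 (display `ψ₂(n) ≪ log² n`)]; (d) progressions: unchanged — the converse for `S(x; q, a, b)` is conditional on DZC and `χ(a) + χ(b) ≠ 0` and leaves `B_q = 1` open unless `a = b` (`BHMS2019_thm1_ii`, PROVED: `BHMS2019_thm1_ii_holds`, whose `a = b` branch gives `B_q ≤ d` directly) [cite: BhowmikHalupczokMatsumotoSuzuki2019, Theorem 1 (2) and Remark 1]; (e) caveats (c) (Granville's prime-only weights) and the Lean-rendering remarks of the catalogued block apply verbatim [cite: Granville2007, Theorem 1A and §5].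
status: established — PROVED here (`GoldbachAverageZerosNarrow_holds`; axioms `propext`, `Classical.choice`, `Quot.sound`), a corollary of the tree's `BHMS2019_thm1_ii_holds` [cite: BhowmikHalupczokMatsumotoSuzuki2019, Theorem 1 (2)] -/
def GoldbachAverageZerosNarrow : Prop :=
  ∀ δ : ℝ, 0 < δ → δ ≤ 1 / 2 → PowerSavingGoldbachAverage δ → QuasiRiemannHypothesis (1 - δ)

/-! ### Glue: the catalogued hypothesis at modulus `1` -/

/-- `S(x; 1, a, b) = S(x)`: with the trivial modulus the restricted average is the full one.
[folklore] -/
theorem goldbachLambdaSumMod_one_eq (a b x : ℕ) :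
    goldbachLambdaSumMod 1 a b x = goldbachLambdaSum x := by
  unfold goldbachLambdaSumMod goldbachLambdaSum
  exact sum_congr rfl fun n _ ↦ goldbachLambdaCountMod_one a b n

/-- A power saving `x^{2−δ}` is the hypothesis of `BHMS2019_thm1_ii` at `q = 1` with `d = 1 − δ`
and every `ε > 0` (`φ(1) = 1`, `x^{2−δ} ≤ x^{1+(1−δ)+ε}`). [folklore] -/
theorem PowerSavingGoldbachAverage.bhms_hypothesis_modOne {δ : ℝ}
    (h : PowerSavingGoldbachAverage δ) (a : ℕ) :
    ∀ ε : ℝ, 0 < ε →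
      (fun x : ℕ ↦ goldbachLambdaSumMod 1 a a x - (x : ℝ) ^ 2 / (2 * (Nat.totient 1 : ℝ) ^ 2))
        =O[atTop] fun x : ℕ ↦ (x : ℝ) ^ (1 + (1 - δ) + ε) := by
  intro ε hε
  have h' : PowerSavingGoldbachAverage (δ - ε) := h.mono (by linarith)
  have hfun : (fun x : ℕ ↦ goldbachLambdaSumMod 1 a a x - (x : ℝ) ^ 2 / (2 * (Nat.totient 1 : ℝ) ^ 2))
      = fun x : ℕ ↦ goldbachLambdaSum x - (x : ℝ) ^ 2 / 2 := by
    funext x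
    rw [goldbachLambdaSumMod_one_eq, Nat.totient_one]
    push_cast
    ring
  have hexp : (fun x : ℕ ↦ (x : ℝ) ^ (1 + (1 - δ) + ε)) = fun x : ℕ ↦ (x : ℝ) ^ (2 - (δ - ε)) := by
    funext x
    congr 1
    ring
  rw [hfun, hexp]
  exact h'

/-- **`B ≤ 1 − δ` at modulus `1`.** For `0 < δ ≤ 1/2`, a power saving `x^{2−δ}` puts every zero of
`L(s, χ)`, `χ` the character mod `1` (`= ζ(s)`), in the strip `0 < Re s < 1` into `Re s ≤ 1 − δ`:
`BHMS2019_thm1_ii_holds` at `q = 1`, `a = b = 1`, where DZC is vacuous (`DirichletCharacter.level_one`)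
and `χ(1) + χ(1) = 2 ≠ 0`. [cite: BhowmikHalupczokMatsumotoSuzuki2019, Theorem 1 (2)] -/
theorem zerosRealPartLE_one_of_powerSaving {δ : ℝ} (hδ : 0 < δ) (hδ2 : δ ≤ 1 / 2)
    (h : PowerSavingGoldbachAverage δ) : ZerosRealPartLE 1 (1 - δ) := by
  have hDZC : DistinctZeroConjecture 1 := fun χ₁ χ₂ hne ↦
    absurd ((DirichletCharacter.level_one χ₁).trans (DirichletCharacter.level_one χ₂).symm) hne
  have hab : ∀ χ : DirichletCharacter ℂ 1, χ ((1 : ℕ) : ZMod 1) + χ ((1 : ℕ) : ZMod 1) ≠ 0 := by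
    intro χ
    rw [DirichletCharacter.level_one χ, MulChar.one_apply (isUnit_of_subsingleton _)]
    norm_num
  exact (BHMS2019_thm1_ii_holds 1 1 1 (Nat.coprime_one_right 1) (Nat.coprime_one_right 1) hDZC hab
    (1 - δ) (by linarith) (by linarith) (h.bhms_hypothesis_modOne 1)).2 rfl

/-! ### The sharp record, proved, and its corollaries -/

/-- **Discharge of the sharp record.** `PowerSavingGoldbachAverage δ`, `0 < δ ≤ 1/2`, gives
`QuasiRiemannHypothesis (1 − δ)`: the `L`-function of the character mod `1` is `riemannZeta`
(Mathlib `DirichletCharacter.LFunction_modOne_eq`). [cite: BhowmikHalupczokMatsumotoSuzuki2019, Theorem 1 (2)]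
[cite: BillingtonEtAl2023, §1 (paragraph after Theorem 2)] -/
theorem GoldbachAverageZerosNarrow_holds : GoldbachAverageZerosNarrow := by
  intro δ hδ hδ2 h s hs hlo hhi
  have hz := zerosRealPartLE_one_of_powerSaving hδ hδ2 h (1 : DirichletCharacter ℂ 1) s
    (by rw [DirichletCharacter.LFunction_modOne_eq]; exact hs) (by linarith) hhi
  linarith

/-- The sharp record read as `B ≤ 1 − δ`: every zero of `ζ` with `Re s < 1` has `Re s ≤ 1 − δ`.
[cite: BhowmikHalupczokMatsumotoSuzuki2019, Theorem 1 (2)] -/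
theorem GoldbachAverageZerosNarrow.re_le (hN : GoldbachAverageZerosNarrow) {δ : ℝ} (hδ : 0 < δ)
    (hδ2 : δ ≤ 1 / 2) (h : PowerSavingGoldbachAverage δ) {s : ℂ} (hs : riemannZeta s = 0)
    (h1 : s.re < 1) : s.re ≤ 1 - δ :=
  not_lt.1 fun hlt ↦ hN δ hδ hδ2 h s hs hlt h1

/-- **At `δ ≥ 1/2` the technique class is the Riemann hypothesis**: a saving `x^{2−δ}`,
`δ ≥ 1/2`, gives `QuasiRiemannHypothesis (1/2)`, which is Mathlib's `RiemannHypothesis`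
(tree `quasiRiemannHypothesis_one_half_iff_holds`, the symmetry `s ↦ 1 − s` of the zeros).
[cite: BhowmikHalupczokMatsumotoSuzuki2019, Theorem 1 (2) and Remark 1] -/
theorem PowerSavingGoldbachAverage.riemannHypothesis {δ : ℝ} (hδ : 1 / 2 ≤ δ)
    (h : PowerSavingGoldbachAverage δ) : RiemannHypothesis := by
  have hq : QuasiRiemannHypothesis (1 - 1 / 2) :=
    GoldbachAverageZerosNarrow_holds (1 / 2) one_half_pos le_rfl (h.mono hδ)
  rw [show (1 : ℝ) - 1 / 2 = 1 / 2 by norm_num] at hq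
  exact quasiRiemannHypothesis_one_half_iff_holds.1 hq

/-- **The sharp record implies the catalogued one** (`GoldbachAverageZeros`, existential in
`δ' ∈ (0, 1)`): given `δ > 0` pass to `δ₁ = min(δ, 1/2)` and take `δ' = δ₁/2`, since
`Re ρ ≤ 1 − δ₁ < 1 − δ₁/2`. [cite: BhowmikRuzsa2018, Theorem 2.1] -/
theorem goldbachAverageZeros_of_narrow (hN : GoldbachAverageZerosNarrow) : GoldbachAverageZeros := by
  intro δ hδ hS
  set δ₁ : ℝ := min δ (1 / 2) with hδ₁
  have hδ₁pos : 0 < δ₁ := lt_min hδ one_half_pos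
  have hδ₁le : δ₁ ≤ 1 / 2 := min_le_right _ _
  have hq := hN δ₁ hδ₁pos hδ₁le (hS.mono (min_le_left _ _))
  refine ⟨δ₁ / 2, by positivity, by linarith, fun s hs _ h1 ↦ ?_⟩
  by_contra hge
  have hge' := not_lt.1 hge
  exact hq s hs (by linarith) h1

end Literature.Barriers.Parity

end
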